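import Literature.Analysis.PDE.ABPPointwise
import Mathlib.Analysis.SpecialFunctions.Log.Deriv
import HarnessLib

/-!
# Hessians of `-log ū` and of a product (calculus for Gilbarg–Trudinger (9.53), p. 247)

Two generic second-order computations in an orthonormal frame `b`, in the matrix format of
`Literature.Analysis.PDE.KrylovSafonov.neg_pair_hessian_log` /
`neg_pair_hessian_product_le`:

* `hessianMatrix_negLog` — for `w = -log φ` (`φ > 0`, `C²` near `x`):
  `H_w = -(φ(x))⁻¹ H_φ + p pᵀ`, `p_i = Dw(x)(b_i)`;
* `hessianMatrix_mul` — for `v = η w`: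
  `H_v = η H_w + p qᵀ + q pᵀ + w H_η`, `p_i = Dw(b_i)`, `q_i = Dη(b_i)`.

## References

* D. Gilbarg, N. S. Trudinger, *Elliptic Partial Differential Equations of Second Order* (2001),
  (9.53) and the first display of the proof of Theorem 9.22. [GilbargTrudinger2001]
-/

noncomputable section

open Set InnerProductSpace Matrix Filter
open scoped Topology

namespace Literature.Analysis.PDE.KrylovSafonov

open Literature.Analysis.PDE.ABP

variable {E : Type*} [NormedAddCommGroup E] [InnerProductSpace ℝ E]
  {ι : Type*} [Fintype ι] [DecidableEq ι]

/-! ### `w = -log φ` -/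

omit [Fintype ι] [DecidableEq ι] in
/-- First derivative of `-log φ`: `D(-log φ)(y) = -(φ y)⁻¹ • Dφ(y)` wherever `φ` is differentiable
and positive. [folklore] -/
theorem hasFDerivAt_negLog {φ : E → ℝ} {y : E} (hφ : DifferentiableAt ℝ φ y) (hpos : 0 < φ y) :
    HasFDerivAt (fun z ↦ -Real.log (φ z)) ((-(φ y)⁻¹) • fderiv ℝ φ y) y := by
  have h := (hφ.hasFDerivAt.log hpos.ne').neg
  refine h.congr_fderiv ?_
  rw [neg_smul]

omit [Fintype ι] [DecidableEq ι] in
/-- `fderiv (-log φ)` near a point where `φ` is differentiable and positive. [folklore] -/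
theorem fderiv_negLog_eventuallyEq {φ : E → ℝ} {x : E}
    (hφ : ∀ᶠ y in 𝓝 x, DifferentiableAt ℝ φ y ∧ 0 < φ y) :
    fderiv ℝ (fun z ↦ -Real.log (φ z)) =ᶠ[𝓝 x] fun y ↦ (-(φ y)⁻¹) • fderiv ℝ φ y := by
  filter_upwards [hφ] with y hy
  exact (hasFDerivAt_negLog hy.1 hy.2).fderiv

omit [Fintype ι] [DecidableEq ι] in
/-- **Second derivative of `-log φ`**:
`D²(-log φ)(x)(v)(w) = -(φ x)⁻¹ D²φ(x)(v)(w) + (φ x)⁻² Dφ(x)(v) Dφ(x)(w)`.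
[cite: GilbargTrudinger2001, proof of Thm 9.22 (computation of `D_{ij}w`)] -/
theorem hasFDerivAt_fderiv_negLog {φ : E → ℝ} {x : E}
    (hφ : ∀ᶠ y in 𝓝 x, DifferentiableAt ℝ φ y ∧ 0 < φ y)
    (hφ2 : DifferentiableAt ℝ (fderiv ℝ φ) x) :
    HasFDerivAt (fderiv ℝ (fun z ↦ -Real.log (φ z)))
      ((-(φ x)⁻¹) • fderiv ℝ (fderiv ℝ φ) x +
        (((φ x) ^ 2)⁻¹ • fderiv ℝ φ x).smulRight (fderiv ℝ φ x)) x := by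
  obtain ⟨hdx, hposx⟩ := hφ.self_of_nhds
  -- derivative of `c(y) = -(φ y)⁻¹`
  have hc : HasFDerivAt (fun y ↦ -(φ y)⁻¹) (((φ x) ^ 2)⁻¹ • fderiv ℝ φ x) x := by
    have h := ((hasDerivAt_inv hposx.ne').comp_hasFDerivAt x hdx.hasFDerivAt).neg
    refine h.congr_fderiv ?_
    rw [← neg_smul, neg_neg]
  have h := hc.smul hφ2.hasFDerivAt
  exact h.congr_of_eventuallyEq (fderiv_negLog_eventuallyEq hφ)

omit [Fintype ι] [DecidableEq ι] in
/-- The second derivative of `-log φ`, evaluated. [folklore] -/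
theorem fderiv_fderiv_negLog_apply {φ : E → ℝ} {x : E}
    (hφ : ∀ᶠ y in 𝓝 x, DifferentiableAt ℝ φ y ∧ 0 < φ y)
    (hφ2 : DifferentiableAt ℝ (fderiv ℝ φ) x) (v w : E) :
    fderiv ℝ (fderiv ℝ (fun z ↦ -Real.log (φ z))) x v w =
      -(φ x)⁻¹ * fderiv ℝ (fderiv ℝ φ) x v w +
        ((φ x) ^ 2)⁻¹ * fderiv ℝ φ x v * fderiv ℝ φ x w := by
  rw [(hasFDerivAt_fderiv_negLog hφ hφ2).fderiv]
  simp [ContinuousLinearMap.smulRight_apply]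

omit [DecidableEq ι] in
/-- **The Hessian matrix of `w = -log φ`**: `H_w = -(φ x)⁻¹ • H_φ + p pᵀ` with
`p_i = Dw(x)(b_i) = -(φ x)⁻¹ Dφ(x)(b_i)`. [cite: GilbargTrudinger2001, proof of Thm 9.22] -/
theorem hessianMatrix_negLog {φ : E → ℝ} {x : E} (b : OrthonormalBasis ι ℝ E)
    (hφ : ∀ᶠ y in 𝓝 x, DifferentiableAt ℝ φ y ∧ 0 < φ y)
    (hφ2 : DifferentiableAt ℝ (fderiv ℝ φ) x) :
    hessianMatrix (fun z ↦ -Real.log (φ z)) b x =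
      -((φ x)⁻¹ • hessianMatrix φ b x) +
        vecMulVec (fun i ↦ fderiv ℝ (fun z ↦ -Real.log (φ z)) x (b i))
          (fun i ↦ fderiv ℝ (fun z ↦ -Real.log (φ z)) x (b i)) := by
  obtain ⟨hdx, hposx⟩ := hφ.self_of_nhds
  have hD1 : ∀ v, fderiv ℝ (fun z ↦ -Real.log (φ z)) x v = -(φ x)⁻¹ * fderiv ℝ φ x v := fun v ↦ by
    rw [(hasFDerivAt_negLog hdx hposx).fderiv]; simp
  ext i j
  rw [hessianMatrix_apply, fderiv_fderiv_negLog_apply hφ hφ2]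
  simp only [Matrix.add_apply, Matrix.neg_apply, Matrix.smul_apply, hessianMatrix_apply,
    smul_eq_mul, vecMulVec_apply, hD1]
  have hφ0 : φ x ≠ 0 := hposx.ne'
  field_simp

/-! ### `v = η w` -/

omit [Fintype ι] [DecidableEq ι] in
/-- `fderiv (η w)` near a point where both factors are differentiable. [folklore] -/
theorem fderiv_mul_eventuallyEq {η w : E → ℝ} {x : E}
    (h : ∀ᶠ y in 𝓝 x, DifferentiableAt ℝ η y ∧ DifferentiableAt ℝ w y) :
    fderiv ℝ (fun z ↦ η z * w z) =ᶠ[𝓝 x] fun y ↦ η y • fderiv ℝ w y + w y • fderiv ℝ η y := by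
  filter_upwards [h] with y hy
  rw [fderiv_fun_mul hy.1 hy.2]

omit [Fintype ι] [DecidableEq ι] in
/-- **Second derivative of a product**:
`D²(ηw)(x)(v)(v') = η D²w(v)(v') + Dη(v) Dw(v') + Dw(v) Dη(v') + w D²η(v)(v')`. [folklore] -/
theorem hasFDerivAt_fderiv_mul {η w : E → ℝ} {x : E}
    (h : ∀ᶠ y in 𝓝 x, DifferentiableAt ℝ η y ∧ DifferentiableAt ℝ w y)
    (hη2 : DifferentiableAt ℝ (fderiv ℝ η) x) (hw2 : DifferentiableAt ℝ (fderiv ℝ w) x) :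
    HasFDerivAt (fderiv ℝ (fun z ↦ η z * w z))
      ((η x • fderiv ℝ (fderiv ℝ w) x + (fderiv ℝ η x).smulRight (fderiv ℝ w x)) +
        (w x • fderiv ℝ (fderiv ℝ η) x + (fderiv ℝ w x).smulRight (fderiv ℝ η x))) x := by
  obtain ⟨hηx, hwx⟩ := h.self_of_nhds
  have h1 := hηx.hasFDerivAt.smul hw2.hasFDerivAt
  have h2 := hwx.hasFDerivAt.smul hη2.hasFDerivAt
  exact (h1.add h2).congr_of_eventuallyEq (fderiv_mul_eventuallyEq h)

omit [Fintype ι] [DecidableEq ι] in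
/-- The second derivative of a product, evaluated. [folklore] -/
theorem fderiv_fderiv_mul_apply {η w : E → ℝ} {x : E}
    (h : ∀ᶠ y in 𝓝 x, DifferentiableAt ℝ η y ∧ DifferentiableAt ℝ w y)
    (hη2 : DifferentiableAt ℝ (fderiv ℝ η) x) (hw2 : DifferentiableAt ℝ (fderiv ℝ w) x) (v v' : E) :
    fderiv ℝ (fderiv ℝ (fun z ↦ η z * w z)) x v v' =
      η x * fderiv ℝ (fderiv ℝ w) x v v' + fderiv ℝ η x v * fderiv ℝ w x v' +
        (w x * fderiv ℝ (fderiv ℝ η) x v v' + fderiv ℝ w x v * fderiv ℝ η x v') := by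
  rw [(hasFDerivAt_fderiv_mul h hη2 hw2).fderiv]
  simp [ContinuousLinearMap.smulRight_apply]

omit [DecidableEq ι] in
/-- **The Hessian matrix of a product**: `H_{ηw} = η H_w + p qᵀ + q pᵀ + w H_η` with
`p_i = Dw(b_i)`, `q_i = Dη(b_i)`. [cite: GilbargTrudinger2001, proof of Thm 9.22
("-a^{ij}D_{ij}v = -ηa^{ij}D_{ij}w - 2a^{ij}D_iηD_jw - wa^{ij}D_{ij}η")] -/
theorem hessianMatrix_mul {η w : E → ℝ} {x : E} (b : OrthonormalBasis ι ℝ E)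
    (h : ∀ᶠ y in 𝓝 x, DifferentiableAt ℝ η y ∧ DifferentiableAt ℝ w y)
    (hη2 : DifferentiableAt ℝ (fderiv ℝ η) x) (hw2 : DifferentiableAt ℝ (fderiv ℝ w) x) :
    hessianMatrix (fun z ↦ η z * w z) b x =
      η x • hessianMatrix w b x +
        vecMulVec (fun i ↦ fderiv ℝ w x (b i)) (fun i ↦ fderiv ℝ η x (b i)) +
        vecMulVec (fun i ↦ fderiv ℝ η x (b i)) (fun i ↦ fderiv ℝ w x (b i)) +
        w x • hessianMatrix η b x := by
  ext i j
  rw [hessianMatrix_apply, fderiv_fderiv_mul_apply h hη2 hw2]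
  simp only [Matrix.add_apply, Matrix.smul_apply, hessianMatrix_apply, smul_eq_mul,
    vecMulVec_apply]
  ring

/-! ### Regularity of the product and symmetry of the second derivatives -/

omit [Fintype ι] [DecidableEq ι] in
/-- `D²(ηw)` exists where the data do. [folklore] -/
theorem differentiableAt_fderiv_mul {η w : E → ℝ} {x : E}
    (h : ∀ᶠ y in 𝓝 x, DifferentiableAt ℝ η y ∧ DifferentiableAt ℝ w y)
    (hη2 : DifferentiableAt ℝ (fderiv ℝ η) x) (hw2 : DifferentiableAt ℝ (fderiv ℝ w) x) :
    DifferentiableAt ℝ (fderiv ℝ (fun z ↦ η z * w z)) x :=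
  (hasFDerivAt_fderiv_mul h hη2 hw2).differentiableAt

omit [Fintype ι] [DecidableEq ι] in
/-- `D²(-log φ)` exists where the data do. [folklore] -/
theorem differentiableAt_fderiv_negLog {φ : E → ℝ} {x : E}
    (hφ : ∀ᶠ y in 𝓝 x, DifferentiableAt ℝ φ y ∧ 0 < φ y)
    (hφ2 : DifferentiableAt ℝ (fderiv ℝ φ) x) :
    DifferentiableAt ℝ (fderiv ℝ (fun z ↦ -Real.log (φ z))) x :=
  (hasFDerivAt_fderiv_negLog hφ hφ2).differentiableAt

omit [Fintype ι] [DecidableEq ι] in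
/-- Symmetry of `D²(-log φ)` from symmetry of `D²φ`. [folklore] -/
theorem fderiv_fderiv_negLog_symm {φ : E → ℝ} {x : E}
    (hφ : ∀ᶠ y in 𝓝 x, DifferentiableAt ℝ φ y ∧ 0 < φ y)
    (hφ2 : DifferentiableAt ℝ (fderiv ℝ φ) x)
    (hsymm : ∀ v w, fderiv ℝ (fderiv ℝ φ) x v w = fderiv ℝ (fderiv ℝ φ) x w v) (v w : E) :
    fderiv ℝ (fderiv ℝ (fun z ↦ -Real.log (φ z))) x v w =
      fderiv ℝ (fderiv ℝ (fun z ↦ -Real.log (φ z))) x w v := by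
  rw [fderiv_fderiv_negLog_apply hφ hφ2, fderiv_fderiv_negLog_apply hφ hφ2, hsymm v w]
  ring

omit [Fintype ι] [DecidableEq ι] in
/-- Symmetry of `D²(ηw)` from symmetry of `D²η` and `D²w`. [folklore] -/
theorem fderiv_fderiv_mul_symm {η w : E → ℝ} {x : E}
    (h : ∀ᶠ y in 𝓝 x, DifferentiableAt ℝ η y ∧ DifferentiableAt ℝ w y)
    (hη2 : DifferentiableAt ℝ (fderiv ℝ η) x) (hw2 : DifferentiableAt ℝ (fderiv ℝ w) x)
    (hηs : ∀ v v', fderiv ℝ (fderiv ℝ η) x v v' = fderiv ℝ (fderiv ℝ η) x v' v)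
    (hws : ∀ v v', fderiv ℝ (fderiv ℝ w) x v v' = fderiv ℝ (fderiv ℝ w) x v' v) (v v' : E) :
    fderiv ℝ (fderiv ℝ (fun z ↦ η z * w z)) x v v' =
      fderiv ℝ (fderiv ℝ (fun z ↦ η z * w z)) x v' v := by
  rw [fderiv_fderiv_mul_apply h hη2 hw2, fderiv_fderiv_mul_apply h hη2 hw2, hηs v v', hws v v']
  ring

end Literature.Analysis.PDE.KrylovSafonov

end
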